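import Literature.NumberTheory.LFunctions.ExceptionalZeroFromSmallLOne
import Literature.NumberTheory.LFunctions.DirichletLFunctionInverseBoundSharp
import HarnessLib

/-!
# Small `L(1,χ)` forces an exceptional zero (Montgomery–Vaughan Theorem 11.4 at `s = 1`): PROVED

Topic `Literature/NumberTheory/LFunctions`. Everything in this file is PROVED (theorems only); it
DISCHARGES the named fact
`Literature.NumberTheory.LFunctions.montgomeryVaughan2007_theorem114_dichotomy` of
`ExceptionalZeroFromSmallLOne.lean` (statement file untouched):

> there are absolute `c₁, C > 0` such that for every `q ≥ 2` and every non-principal `χ` mod `q`,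
> EITHER `|L(1,χ)| ≥ c₁/log(4q)` OR `L(s,χ)` has a real zero `β < 1` with `1 − β ≤ C·|L(1,χ)|`.

The proof is the specialisation to `s = 1` of the tree's PROVED sharp form of MV Theorem 11.4,
`Literature.NumberTheory.LFunctions.DirichletZFR.exists_inv_LFunction_bounds_sharp`
(`DirichletLFunctionInverseBoundSharp.lean`; (11.7)/(11.10) with absolute `c, C > 0`,
`ℒ₀ = log q + log 4`):

* (A) if `L(s,χ)` has no real zero `β > 1 − 2c/ℒ₀`, then `‖1/L(1,χ)‖ ≤ C ℒ₀`, whence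
  `|L(1,χ)| ≥ 1/(C ℒ₀) ≥ (1/(2C))/log(4q)`;
* (B) if `β > 1 − 2c/ℒ₀` is a real zero, then `‖1/L(1,χ)‖ ≤ C (ℒ₀ + 1/(1 − β))` (`β < 1` because
  `L(s,χ) ≠ 0` on `σ ≥ 1`, Mathlib `DirichletCharacter.LFunction_ne_zero_of_one_le_re`); if
  `1/(1 − β) < ℒ₀` this gives `|L(1,χ)| ≥ 1/(2Cℒ₀)` again, and otherwise
  `|L(1,χ)| ≥ (1 − β)/(2C)`, i.e. `1 − β ≤ 2C |L(1,χ)|`.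

So the fact holds with `c₁ = 1/(2C)` and `C' = 2C`. No new definition, no new named fact
(D-0026: net debt −1). Consequence in the tree: the bridges
`Literature.NumberTheory.LFunctions.Zhang2022.KnifeEdgeLenSiegelModuli.realZero_of_assumptionA` and
`….isSiegelZero_of_assumptionA` ("Zhang's Assumption (A) forces a Siegel zero of quality
`≫ 𝓛²⁰²¹`"), stated there under the hypothesis `(h : montgomeryVaughan2007_theorem114_dichotomy)`,
can now be fed `montgomeryVaughan2007_theorem114_dichotomy_holds`.

«The programme SEARCHES and TYPES; no claim about Landau–Siegel zeros, Theorems 1–2 of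
arXiv:2211.02515 or a repaired Margin232 until a kernel theorem says so.»

## References

* H. L. Montgomery, R. C. Vaughan, *Multiplicative Number Theory I. Classical Theory*, Cambridge
  Stud. Adv. Math. 97 (2007), §11.1 Theorem 11.4, (11.7), (11.10), proof pp. 277–278
  (`MontgomeryVaughan2007`).
-/

noncomputable section

open Complex

namespace Literature.NumberTheory.LFunctions

/-- **Montgomery–Vaughan Theorem 11.4 at `s = 1` (the exceptional-zero dichotomy): PROVED**, with
`c₁ = 1/(2C)`, `C' = 2C` for the constant `C` of
`Literature.NumberTheory.LFunctions.DirichletZFR.exists_inv_LFunction_bounds_sharp`.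
[cite: MontgomeryVaughan2007, §11.1 Theorem 11.4 (11.7) (11.10)] -/
theorem montgomeryVaughan2007_theorem114_dichotomy_holds :
    montgomeryVaughan2007_theorem114_dichotomy := by
  obtain ⟨c, hc, C, hC, hA, hB⟩ := DirichletZFR.exists_inv_LFunction_bounds_sharp
  refine ⟨1 / (2 * C), 2 * C, by positivity, by positivity, ?_⟩
  intro q _ χ hq χne
  have hq0 : (0 : ℝ) < (q : ℝ) := by exact_mod_cast (lt_of_lt_of_le (by norm_num) hq)
  have hℒ₀1 : 1 ≤ Real.log q + Real.log 4 := PagePNT.one_le_ell0 q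
  have hℒ₀0 : 0 < Real.log q + Real.log 4 := by linarith
  have hlog4q : Real.log (4 * (q : ℝ)) = Real.log q + Real.log 4 := by
    rw [Real.log_mul (by norm_num) hq0.ne', add_comm]
  -- the point `s = 1` lies in the region `σ ≥ 1 − c/ℒ`
  have h1re : 1 - c / (Real.log q + Real.log (|(1 : ℂ).im| + 4)) ≤ (1 : ℂ).re := by
    simp only [Complex.one_re, Complex.one_im, abs_zero, zero_add]
    have : 0 ≤ c / (Real.log q + Real.log 4) := by positivity
    linarith
  have hL1 : χ.LFunction 1 ≠ 0 :=
    DirichletCharacter.LFunction_ne_zero_of_one_le_re χ (Or.inl χne) (by simp)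
  set x : ℝ := ‖χ.LFunction 1‖ with hx
  have hx0 : 0 < x := norm_pos_iff.2 hL1
  have hinv : ‖(χ.LFunction 1)⁻¹‖ = 1 / x := by rw [norm_inv, hx, inv_eq_one_div]
  -- the first alternative from `1/x ≤ 2 C ℒ₀`
  have left_of : 1 / x ≤ 2 * C * (Real.log q + Real.log 4) →
      1 / (2 * C) / Real.log (4 * (q : ℝ)) ≤ x := by
    intro h
    rw [hlog4q, div_div, div_le_iff₀ (by positivity)]
    rw [div_le_iff₀ hx0] at h
    linarith
  by_cases hex : ∃ β : ℝ, χ.LFunction β = 0 ∧ 1 - 2 * c / (Real.log q + Real.log 4) < β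
  · -- (B): an exceptional zero `β`
    obtain ⟨β, hβ, hβc⟩ := hex
    have hβ1 : β < 1 := by
      by_contra hcon
      push Not at hcon
      exact DirichletCharacter.LFunction_ne_zero_of_one_le_re χ (Or.inl χne)
        (by simpa using hcon) hβ
    have hδ : 0 < 1 - β := by linarith
    have hne : (1 : ℂ) ≠ (β : ℂ) := by
      intro h
      have h' := congrArg Complex.re h
      simp at h'
      linarith
    obtain ⟨-, hbound⟩ := hB q χ χne β hβ hβc 1 h1re hne
    have hnorm1β : ‖(1 : ℂ) - (β : ℂ)‖ = 1 - β := by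
      rw [show (1 : ℂ) - (β : ℂ) = ((1 - β : ℝ) : ℂ) by push_cast; ring, Complex.norm_real,
        Real.norm_eq_abs, abs_of_pos hδ]
    simp only [Complex.one_im, abs_zero, zero_add] at hbound
    rw [hnorm1β, hinv, inv_eq_one_div] at hbound
    -- hbound : 1 / x ≤ C * ((log q + log 4) + 1 / (1 - β))
    by_cases hclose : Real.log q + Real.log 4 ≤ 1 / (1 - β)
    · -- the zero is close to `1`: second alternative
      right
      refine ⟨β, hβ1, ?_, hβ⟩
      have h2 : 1 / x ≤ 2 * C / (1 - β) := by
        have : C * ((Real.log q + Real.log 4) + 1 / (1 - β)) ≤ 2 * C / (1 - β) := by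
          rw [show 2 * C / (1 - β) = C * (1 / (1 - β) + 1 / (1 - β)) by ring]
          exact mul_le_mul_of_nonneg_left (by linarith) hC.le
        exact hbound.trans this
      rw [div_le_div_iff₀ hx0 hδ] at h2
      linarith
    · -- the zero is far from `1`: first alternative
      left
      push Not at hclose
      apply left_of
      have : C * ((Real.log q + Real.log 4) + 1 / (1 - β)) ≤ 2 * C * (Real.log q + Real.log 4) := by
        rw [show 2 * C * (Real.log q + Real.log 4) =
          C * ((Real.log q + Real.log 4) + (Real.log q + Real.log 4)) by ring]
        exact mul_le_mul_of_nonneg_left (by linarith) hC.le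
      exact hbound.trans this
  · -- (A): no exceptional zero
    left
    push Not at hex
    have hnone : ∀ β : ℝ, χ.LFunction β = 0 → β ≤ 1 - 2 * c / (Real.log q + Real.log 4) :=
      fun β hβ ↦ hex β hβ
    obtain ⟨-, hbound⟩ := hA q χ χne hnone 1 h1re
    simp only [Complex.one_im, abs_zero, zero_add] at hbound
    rw [hinv] at hbound
    apply left_of
    have : C * (Real.log q + Real.log 4) ≤ 2 * C * (Real.log q + Real.log 4) := by nlinarith
    exact hbound.trans this

end Literature.NumberTheory.LFunctions
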